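import Summits.ABC.ABC.Theorems.RibetTakahashiSplitFewPrimeValuationProductStubDecisivePrimeBootstrapLemmas
import HarnessLib

/-!
# The hard core with a small member (stub `hardCore_smallMember_of_lfl`)

Helper (`--supports`) for the crux
`Summit.ABC.ABC.Theses.RibetTakahashiSplit.FewPrimeValuationProduct` (stmt-ABC-1563), line
`matveev-face-clearing`: the registered sub-goal `hardCore_smallMember_of_lfl`, a dividend of
the open stub `stub_hardCore` that is unconditional modulo the linear-forms input
`∃ K ≥ 1, PastenApproximationBound K` (the neighbouring stub `stub_lflInput`; Matveev + Yu over
`ℚ` in the form of H. Pasten, Invent. Math. 236 (2024), Thm 2.1), taken here as an explicit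
hypothesis.

**Statement.** Fix `A : ℝ` and `ε > 0`. There is `C` such that for all pairwise distinct odd primes
`p, q, r` and exponents `x, y, z, k` with `p^x + q^y = 2^k r^z`, `p^x + 2^k r^z = q^y` or
`q^y + 2^k r^z = p^x`, if the smallest of `p^x, q^y, 2^k r^z` is `≤ (2pqr)^A` then
`x·y·z·k ≤ C · (2pqr)^ε`.

**Proof ("balance is automatic").** Write the solution as an abc triple `a + b = c`
(`{a, b, c} = {p^x, q^y, 2^k r^z}`, pairwise coprime, `abc` supported on `{2, p, q, r}`), put
`R = 2pqr`, `Λ = max(log R, 1)`. The member `≤ R^A` may be taken to be `a`: if it is `c` then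
`a ≤ c ≤ R^A`, if it is `b` swap `a` and `b`. The archimedean clause of the approximation bound at
threshold `N = 0` (`Pasten.arch_bound`) is `log c − log a < Θ_{b,c} · log max{e, 2 log c}` with
`Θ_{b,c} = theta K b c 0 ≤ K⁵ Λ⁴` (`decisivePrimeBootstrap_theta_zero_le`: `bc` has `≤ 4` prime
factors, all `≤ R`). Hence `log c ≤ A Λ + K⁵ Λ⁴ · log max{e, 2 log c}`; this implicit bound is
closed by the self-improvement `y ≤ M log max{e, 2y} ⟹ y ≤ 2M log(4M)`
(`Literature.Barriers.ABC.le_of_le_mul_log_max`, `M = (A + K⁵) Λ⁴`), giving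
`log c ≤ C₂ Λ⁵`, `C₂ = 2 (A + K⁵)(log(4(A + K⁵)) + 4)` (for `A ≥ 1`; in general replace `A` by
`max(A, 1)`). Every member is `≤ c`, so `x, y, z, k ≤ log c / log 2`, and
`x·y·z·k ≤ (C₂ / log 2)⁴ Λ²⁰ ≤ C R^ε` by `decisivePrimeBootstrap_polylog_le_rpow`. All constants are
existential and generous. The open stub `stub_hardCore` (no small member) is not touched.
-/

-- `Summit.ABC.ABC` is the mandated summit-side namespace (CONVENTIONS §2); the duplicate is
-- deliberate.
set_option linter.dupNamespace false

noncomputable section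

namespace Summit.ABC.ABC.Theorems.FewPrimeValuationProduct

open Literature.NumberTheory.DiophantineGeometry
open Literature.NumberTheory.DiophantineGeometry.Dioph
open Literature.NumberTheory.DiophantineGeometry.Pasten
open Literature.Barriers.ABC

/-! ## Closing the implicit bound -/

/-- **Closing the implicit bound** (pure analysis). If `K, A, Λ ≥ 1` and
`y ≤ A Λ + K⁵ Λ⁴ · log max{e, 2y}`, then `y ≤ 2 (A + K⁵) (log(4(A + K⁵)) + 4) Λ⁵`:
self-improvement `le_of_le_mul_log_max` with `M = (A + K⁵) Λ⁴`, then
`log(4M) = log(4(A + K⁵)) + 4 log Λ ≤ (log(4(A + K⁵)) + 4) Λ`. [folklore] -/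
theorem hardCoreSmallMember_analysis {K A Λ y : ℝ} (hK : 1 ≤ K) (hA : 1 ≤ A) (hΛ : 1 ≤ Λ)
    (h : y ≤ A * Λ + K ^ 5 * Λ ^ 4 * Real.log (max (Real.exp 1) (2 * y))) :
    y ≤ 2 * (A + K ^ 5) * (Real.log (4 * (A + K ^ 5)) + 4) * Λ ^ 5 := by
  -- adapted from `…StubFaceBound.lean` (`faceBound_analysis`)
  set Y : ℝ := Real.log (max (Real.exp 1) (2 * y))
  set M : ℝ := (A + K ^ 5) * Λ ^ 4 with hM
  set c₀ : ℝ := Real.log (4 * (A + K ^ 5)) with hc₀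
  have hΛ0 : 0 < Λ := by linarith
  have hK5 : 1 ≤ K ^ 5 := one_le_pow₀ hK
  have hΛ4 : 1 ≤ Λ ^ 4 := one_le_pow₀ hΛ
  have hY1 : 1 ≤ Y := one_le_log_max_exp _
  have hA0 : 0 ≤ A := by linarith
  have hΛΛ4 : Λ ≤ Λ ^ 4 :=
    calc Λ = Λ ^ 1 := (pow_one Λ).symm
      _ ≤ Λ ^ 4 := pow_le_pow_right₀ hΛ (by norm_num)
  have hM1 : 1 ≤ M := one_le_mul_of_one_le_of_one_le (by linarith) hΛ4
  have hM0 : 0 ≤ M := zero_le_one.trans hM1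
  have h1 : y ≤ M * Y := by
    have t1 : A * Λ ≤ A * Λ ^ 4 * Y :=
      calc A * Λ ≤ A * Λ ^ 4 := mul_le_mul_of_nonneg_left hΛΛ4 hA0
        _ ≤ A * Λ ^ 4 * Y := le_mul_of_one_le_right (mul_nonneg hA0 (by positivity)) hY1
    calc y ≤ A * Λ + K ^ 5 * Λ ^ 4 * Y := h
      _ ≤ A * Λ ^ 4 * Y + K ^ 5 * Λ ^ 4 * Y := by linarith
      _ = M * Y := by rw [hM]; ring
  have h2 : y ≤ 2 * M * Real.log (4 * M) := le_of_le_mul_log_max hM1 h1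
  have hc₀0 : 0 ≤ c₀ := Real.log_nonneg (by linarith)
  have hlog4M : Real.log (4 * M) ≤ (c₀ + 4) * Λ := by
    have h4M : 4 * M = (4 * (A + K ^ 5)) * Λ ^ 4 := by rw [hM]; ring
    have hexp : Real.log (4 * M) = c₀ + 4 * Real.log Λ := by
      rw [h4M, Real.log_mul (show (0 : ℝ) < 4 * (A + K ^ 5) by linarith).ne' (pow_pos hΛ0 4).ne',
        Real.log_pow, hc₀]
      push_cast
      ring
    have hlogΛ : Real.log Λ ≤ Λ := Real.log_le_self hΛ0.le
    have hc₀Λ : c₀ ≤ c₀ * Λ := le_mul_of_one_le_right hc₀0 hΛ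
    rw [hexp]
    nlinarith
  calc y ≤ 2 * M * Real.log (4 * M) := h2
    _ ≤ 2 * M * ((c₀ + 4) * Λ) := mul_le_mul_of_nonneg_left hlog4M (by linarith)
    _ = 2 * (A + K ^ 5) * (c₀ + 4) * Λ ^ 5 := by rw [hM]; ring

/-! ## One abc triple with a small member -/

/-- **The route through a small member.** Let `a + b = c` be an abc triple with `bc ∣ n ≠ 0`,
`ω(n) ≤ 4` and every prime of `n` at most `R ≥ 1`, and suppose `a ≤ R^A` (`A ≥ 1`). Under
`PastenApproximationBound K` (`K ≥ 1`):
`log c ≤ 2 (A + K⁵)(log(4(A + K⁵)) + 4) · max(log R, 1)⁵` (the archimedean clause `arch_bound`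
at threshold `0`, `Θ_{b,c} ≤ K⁵Λ⁴`, `log a ≤ A Λ`, and `hardCoreSmallMember_analysis`).
[folklore] -/
theorem hardCoreSmallMember_route {K A R : ℝ} (hK : 1 ≤ K) (hP : PastenApproximationBound K)
    (hA : 1 ≤ A) (hR : 1 ≤ R) {a b c n : ℕ} (h : IsABCTriple a b c) (hn : n ≠ 0)
    (hbc : b * c ∣ n) (hcard : n.primeFactors.card ≤ 4)
    (hle : ∀ l ∈ n.primeFactors, (l : ℝ) ≤ R) (ha : (a : ℝ) ≤ R ^ A) :
    Real.log c ≤ 2 * (A + K ^ 5) * (Real.log (4 * (A + K ^ 5)) + 4) * max (Real.log R) 1 ^ 5 := by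
  obtain ⟨ha0, hb0, habc, -⟩ := id h
  have hc : c ≠ 0 := by omega
  set Λ : ℝ := max (Real.log R) 1
  have hΛ1 : 1 ≤ Λ := le_max_right _ _
  have hR0 : 0 < R := by linarith
  -- `Θ_{b,c} ≤ K⁵ Λ⁴`
  have hsub : (b * c).primeFactors ⊆ n.primeFactors := Nat.primeFactors_mono hbc hn
  have hcard' : (b * c).primeFactors.card ≤ 4 := (Finset.card_le_card hsub).trans hcard
  have hlog : ∀ l ∈ (b * c).primeFactors, Real.log l ≤ Λ := fun l hl =>
    (Real.log_le_log (by exact_mod_cast (Nat.prime_of_mem_primeFactors hl).pos)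
      (hle l (hsub hl))).trans (le_max_left _ _)
  have hΘ : theta K b c 0 ≤ K ^ 5 * Λ ^ 4 :=
    decisivePrimeBootstrap_theta_zero_le hK hΛ1 hb0.ne' hc (coprime_right_of_isABCTriple h)
      hcard' hlog
  -- the archimedean clause and `log a ≤ A Λ`
  set Y : ℝ := Real.log (max (Real.exp 1) (2 * Real.log c))
  have hY0 : 0 ≤ Y := zero_le_one.trans (one_le_log_max_exp _)
  have harch : Real.log c - Real.log a < theta K b c 0 * Y := arch_bound hK hP h 0
  have hloga : Real.log a ≤ A * Λ :=
    calc Real.log a ≤ Real.log (R ^ A) := Real.log_le_log (by exact_mod_cast ha0) ha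
      _ = A * Real.log R := Real.log_rpow hR0 A
      _ ≤ A * Λ := mul_le_mul_of_nonneg_left (le_max_left _ _) (by linarith)
  have hΘY : theta K b c 0 * Y ≤ K ^ 5 * Λ ^ 4 * Y := mul_le_mul_of_nonneg_right hΘ hY0
  have hmain : Real.log c ≤ A * Λ + K ^ 5 * Λ ^ 4 * Y := by linarith
  exact hardCoreSmallMember_analysis hK hA hΛ1 hmain

/-- **Any small member will do.** As `hardCoreSmallMember_route`, with `abc = n` and the small
member any of `a, b, c` (if it is `c`, then `a ≤ c`; if it is `b`, swap `a` and `b`). [folklore] -/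
theorem hardCoreSmallMember_triple {K A R : ℝ} (hK : 1 ≤ K) (hP : PastenApproximationBound K)
    (hA : 1 ≤ A) (hR : 1 ≤ R) {a b c n : ℕ} (h : IsABCTriple a b c) (hn : a * b * c = n)
    (hcard : n.primeFactors.card ≤ 4) (hle : ∀ l ∈ n.primeFactors, (l : ℝ) ≤ R)
    (hsmall : (a : ℝ) ≤ R ^ A ∨ (b : ℝ) ≤ R ^ A ∨ (c : ℝ) ≤ R ^ A) :
    Real.log c ≤ 2 * (A + K ^ 5) * (Real.log (4 * (A + K ^ 5)) + 4) * max (Real.log R) 1 ^ 5 := by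
  obtain ⟨ha0, hb0, habc, hcop⟩ := id h
  have hn0 : n ≠ 0 := by
    rw [← hn]
    exact mul_ne_zero (mul_ne_zero ha0.ne' hb0.ne') (by omega)
  have h' : IsABCTriple b a c := ⟨hb0, ha0, by omega, hcop.symm⟩
  have hbc : b * c ∣ n := ⟨a, by rw [← hn]; ring⟩
  have hac : a * c ∣ n := ⟨b, by rw [← hn]; ring⟩
  rcases hsmall with hsa | hsb | hsc
  · exact hardCoreSmallMember_route hK hP hA hR h hn0 hbc hcard hle hsa
  · exact hardCoreSmallMember_route hK hP hA hR h' hn0 hac hcard hle hsb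
  · have hac' : (a : ℝ) ≤ c := by exact_mod_cast (show a ≤ c by omega)
    exact hardCoreSmallMember_route hK hP hA hR h hn0 hbc hcard hle (hac'.trans hsc)

/-! ## From `log c` to the exponents; the prime support -/

/-- `m ≤ T / log 2` when `s^m ≤ c`, `s ≥ 2` and `log c ≤ T` (`m log 2 ≤ m log s ≤ log c`).
[folklore] -/
theorem hardCoreSmallMember_exp_le {s m c : ℕ} {T : ℝ} (hs : 2 ≤ s) (hle : s ^ m ≤ c)
    (hlogc : Real.log c ≤ T) : (m : ℝ) ≤ T / Real.log 2 := by
  have hlog2 : 0 < Real.log 2 := Real.log_pos one_lt_two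
  rw [le_div_iff₀ hlog2]
  have hs' : (2 : ℝ) ≤ s := by exact_mod_cast hs
  have h1 : (s : ℝ) ^ m ≤ c := by exact_mod_cast hle
  have h2 : Real.log ((s : ℝ) ^ m) ≤ Real.log c := Real.log_le_log (pow_pos (by linarith) m) h1
  rw [Real.log_pow] at h2
  calc (m : ℝ) * Real.log 2 ≤ m * Real.log s :=
        mul_le_mul_of_nonneg_left (Real.log_le_log two_pos hs') (Nat.cast_nonneg m)
    _ ≤ Real.log c := h2
    _ ≤ T := hlogc

/-- The primes of `p^x · q^y · (2^k · r^z)` (`p, q, r` prime) lie in `{2, p, q, r}`. [folklore] -/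
theorem hardCoreSmallMember_primeFactors_subset {p q r x y z k : ℕ} (hp : p.Prime)
    (hq : q.Prime) (hr : r.Prime) :
    (p ^ x * q ^ y * (2 ^ k * r ^ z)).primeFactors ⊆ {2, p, q, r} := by
  intro l hl
  have hlp : l.Prime := Nat.prime_of_mem_primeFactors hl
  have hln : l ∣ p ^ x * q ^ y * (2 ^ k * r ^ z) := Nat.dvd_of_mem_primeFactors hl
  simp only [Finset.mem_insert, Finset.mem_singleton]
  rcases hlp.dvd_mul.mp hln with h₁ | h₂
  · rcases hlp.dvd_mul.mp h₁ with h₁₁ | h₁₂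
    · exact Or.inr (Or.inl ((Nat.prime_dvd_prime_iff_eq hlp hp).mp (hlp.dvd_of_dvd_pow h₁₁)))
    · exact Or.inr (Or.inr (Or.inl
        ((Nat.prime_dvd_prime_iff_eq hlp hq).mp (hlp.dvd_of_dvd_pow h₁₂))))
  · rcases hlp.dvd_mul.mp h₂ with h₂₁ | h₂₂
    · exact Or.inl ((Nat.prime_dvd_prime_iff_eq hlp Nat.prime_two).mp (hlp.dvd_of_dvd_pow h₂₁))
    · exact Or.inr (Or.inr (Or.inr
        ((Nat.prime_dvd_prime_iff_eq hlp hr).mp (hlp.dvd_of_dvd_pow h₂₂))))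

/-! ## The stub -/

/-- **Stub `hardCore_smallMember_of_lfl` of line `matveev-face-clearing` (crux
`FewPrimeValuationProduct`, stmt-ABC-1563): the hard core with a small member.** If
`PastenApproximationBound K` holds for some `K ≥ 1` (Matveev + Yu over `ℚ` in Pasten's form), then
for every `A : ℝ` and `ε > 0` there is `C` such that every solution of `p^x + q^y = 2^k r^z`,
`p^x + 2^k r^z = q^y` or `q^y + 2^k r^z = p^x` in pairwise distinct odd primes `p, q, r` whose
smallest member is `≤ (2pqr)^A` satisfies `x·y·z·k ≤ C · (2pqr)^ε`. Proof: the solution is an abc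
triple supported on `{2, p, q, r}`; `hardCoreSmallMember_triple` (archimedean clause at threshold
`0`, `Θ ≤ K⁵Λ⁴`, self-improvement) gives `log c ≤ C₂ Λ⁵` with `Λ = max(log 2pqr, 1)`; every member
is `≤ c`, so each exponent is `≤ C₂ Λ⁵ / log 2`, and `Λ²⁰ ≤ D (2pqr)^ε`. [folklore] -/
theorem hardCore_smallMember_of_lfl :
    (∃ K : ℝ, 1 ≤ K ∧
      Literature.NumberTheory.DiophantineGeometry.Dioph.PastenApproximationBound K) →
    ∀ A : ℝ, ∀ ε : ℝ, 0 < ε → ∃ C : ℝ, ∀ p q r x y z k : ℕ, p.Prime → q.Prime → r.Prime →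
      Odd p → Odd q → Odd r → p ≠ q → p ≠ r → q ≠ r → 0 < x → 0 < y → 0 < z → 0 < k →
      (p ^ x + q ^ y = 2 ^ k * r ^ z ∨ p ^ x + 2 ^ k * r ^ z = q ^ y ∨
        q ^ y + 2 ^ k * r ^ z = p ^ x) →
      (min (min ((p : ℝ) ^ x) ((q : ℝ) ^ y)) ((2 : ℝ) ^ k * (r : ℝ) ^ z) ≤
        ((2 * p * q * r : ℕ) : ℝ) ^ A) →
      ((x * y * z * k : ℕ) : ℝ) ≤ C * ((2 * p * q * r : ℕ) : ℝ) ^ ε := by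
  rintro ⟨K, hK, hP⟩ A ε hε
  set A' : ℝ := max A 1
  set C₂ : ℝ := 2 * (A' + K ^ 5) * (Real.log (4 * (A' + K ^ 5)) + 4) with hC₂
  obtain ⟨D, -, hD⟩ := decisivePrimeBootstrap_polylog_le_rpow 20 hε
  have hA'1 : 1 ≤ A' := le_max_right _ _
  have hK5 : 1 ≤ K ^ 5 := one_le_pow₀ hK
  have hC₂0 : 0 ≤ C₂ := by
    have hlog : 0 ≤ Real.log (4 * (A' + K ^ 5)) := Real.log_nonneg (by linarith)
    rw [hC₂]
    exact mul_nonneg (mul_nonneg two_pos.le (by linarith)) (by linarith)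
  refine ⟨(C₂ / Real.log 2) ^ 4 * D, ?_⟩
  intro p q r x y z k hp hq hr hpo hqo _hro hpq hpr hqr _hx _hy _hz _hk hdisj hmin
  have hp2 : p ≠ 2 := by have := Nat.odd_iff.mp hpo; omega
  have hq2 : q ≠ 2 := by have := Nat.odd_iff.mp hqo; omega
  -- `R = 2pqr` and `Λ = max(log R, 1)`
  have hRpos : 0 < 2 * p * q * r :=
    Nat.mul_pos (Nat.mul_pos (Nat.mul_pos two_pos hp.pos) hq.pos) hr.pos
  set R : ℝ := ((2 * p * q * r : ℕ) : ℝ) with hR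
  have hR1 : 1 ≤ R := by rw [hR]; exact_mod_cast Nat.one_le_iff_ne_zero.mpr hRpos.ne'
  set Λ : ℝ := max (Real.log R) 1
  have hΛ0 : 0 ≤ Λ := zero_le_one.trans (le_max_right _ _)
  -- the product `n` of the three members: `ω(n) ≤ 4`, primes `≤ R`
  set n : ℕ := p ^ x * q ^ y * (2 ^ k * r ^ z) with hn
  have hsub : n.primeFactors ⊆ {2, p, q, r} :=
    hardCoreSmallMember_primeFactors_subset (x := x) (y := y) (z := z) (k := k) hp hq hr
  have hcard : n.primeFactors.card ≤ 4 := (Finset.card_le_card hsub).trans Finset.card_le_four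
  have hle : ∀ l ∈ n.primeFactors, (l : ℝ) ≤ R := by
    intro l hl
    have hl' := hsub hl
    simp only [Finset.mem_insert, Finset.mem_singleton] at hl'
    have hdvd : l ∣ 2 * p * q * r := by
      rcases hl' with h | h | h | h <;> rw [h]
      exacts [⟨p * q * r, by ring⟩, ⟨2 * q * r, by ring⟩, ⟨2 * p * r, by ring⟩,
        ⟨2 * p * q, by ring⟩]
    rw [hR]
    exact_mod_cast Nat.le_of_dvd hRpos hdvd
  -- the members: positivity, coprimality, and a small one
  have hP0 : 0 < p ^ x := pow_pos hp.pos x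
  have hQ0 : 0 < q ^ y := pow_pos hq.pos y
  have hS0 : 0 < 2 ^ k * r ^ z := Nat.mul_pos (pow_pos two_pos k) (pow_pos hr.pos z)
  have hcPQ : (p ^ x).Coprime (q ^ y) := Nat.Coprime.pow x y ((Nat.coprime_primes hp hq).mpr hpq)
  have hcPS : (p ^ x).Coprime (2 ^ k * r ^ z) :=
    Nat.Coprime.mul_right (Nat.Coprime.pow x k ((Nat.coprime_primes hp Nat.prime_two).mpr hp2))
      (Nat.Coprime.pow x z ((Nat.coprime_primes hp hr).mpr hpr))
  have hcQS : (q ^ y).Coprime (2 ^ k * r ^ z) :=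
    Nat.Coprime.mul_right (Nat.Coprime.pow y k ((Nat.coprime_primes hq Nat.prime_two).mpr hq2))
      (Nat.Coprime.pow y z ((Nat.coprime_primes hq hr).mpr hqr))
  have h3 : ((p ^ x : ℕ) : ℝ) ≤ R ^ A' ∨ ((q ^ y : ℕ) : ℝ) ≤ R ^ A' ∨
      ((2 ^ k * r ^ z : ℕ) : ℝ) ≤ R ^ A' := by
    have h' := hmin.trans (Real.rpow_le_rpow_of_exponent_le hR1 (le_max_left A 1))
    simp only [min_le_iff] at h'
    push_cast
    rcases h' with (h | h) | h
    exacts [Or.inl h, Or.inr (Or.inl h), Or.inr (Or.inr h)]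
  -- the solution as an abc triple `a + b = c` with `abc = n` and every member `≤ c`
  obtain ⟨a, b, c, hT, habcn, hsmall, hPc, hQc, hSc⟩ : ∃ a b c : ℕ, IsABCTriple a b c ∧
      a * b * c = n ∧ ((a : ℝ) ≤ R ^ A' ∨ (b : ℝ) ≤ R ^ A' ∨ (c : ℝ) ≤ R ^ A') ∧
      p ^ x ≤ c ∧ q ^ y ≤ c ∧ 2 ^ k * r ^ z ≤ c := by
    rcases hdisj with h₁ | h₂ | h₃
    · exact ⟨p ^ x, q ^ y, 2 ^ k * r ^ z, ⟨hP0, hQ0, h₁, hcPQ⟩, rfl, h3,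
        (by rw [← h₁]; exact Nat.le_add_right _ _), (by rw [← h₁]; exact Nat.le_add_left _ _),
        le_rfl⟩
    · exact ⟨p ^ x, 2 ^ k * r ^ z, q ^ y, ⟨hP0, hS0, h₂, hcPS⟩, (by rw [hn]; ring),
        h3.elim (fun h => Or.inl h) fun h => h.elim (fun h => Or.inr (Or.inr h)) fun h =>
          Or.inr (Or.inl h),
        (by rw [← h₂]; exact Nat.le_add_right _ _), le_rfl,
        (by rw [← h₂]; exact Nat.le_add_left _ _)⟩
    · exact ⟨q ^ y, 2 ^ k * r ^ z, p ^ x, ⟨hQ0, hS0, h₃, hcQS⟩, (by rw [hn]; ring),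
        h3.elim (fun h => Or.inr (Or.inr h)) fun h => h.elim (fun h => Or.inl h) fun h =>
          Or.inr (Or.inl h),
        le_rfl, (by rw [← h₃]; exact Nat.le_add_right _ _),
        (by rw [← h₃]; exact Nat.le_add_left _ _)⟩
  -- `log c ≤ C₂ Λ⁵`, the exponents, and the product
  have hlogc : Real.log c ≤ C₂ * Λ ^ 5 :=
    hardCoreSmallMember_triple hK hP hA'1 hR1 hT habcn hcard hle hsmall
  set T : ℝ := C₂ * Λ ^ 5 / Real.log 2 with hT_def
  have hT0 : 0 ≤ T :=
    div_nonneg (mul_nonneg hC₂0 (pow_nonneg hΛ0 5)) (Real.log_nonneg one_le_two)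
  have hxT : (x : ℝ) ≤ T := hardCoreSmallMember_exp_le hp.two_le hPc hlogc
  have hyT : (y : ℝ) ≤ T := hardCoreSmallMember_exp_le hq.two_le hQc hlogc
  have hkT : (k : ℝ) ≤ T :=
    hardCoreSmallMember_exp_le le_rfl ((Nat.le_mul_of_pos_right _ (pow_pos hr.pos z)).trans hSc)
      hlogc
  have hzT : (z : ℝ) ≤ T :=
    hardCoreSmallMember_exp_le hr.two_le ((Nat.le_mul_of_pos_left _ (pow_pos two_pos k)).trans hSc)
      hlogc
  have hprod : ((x * y * z * k : ℕ) : ℝ) ≤ T ^ 4 := by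
    push_cast
    calc (x : ℝ) * y * z * k ≤ T * T * T * T :=
          mul_le_mul (mul_le_mul (mul_le_mul hxT hyT (Nat.cast_nonneg y) hT0) hzT
            (Nat.cast_nonneg z) (mul_nonneg hT0 hT0)) hkT (Nat.cast_nonneg k)
            (mul_nonneg (mul_nonneg hT0 hT0) hT0)
      _ = T ^ 4 := by ring
  have h40 : 0 ≤ (C₂ / Real.log 2) ^ 4 :=
    pow_nonneg (div_nonneg hC₂0 (Real.log_nonneg one_le_two)) 4
  calc ((x * y * z * k : ℕ) : ℝ) ≤ T ^ 4 := hprod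
    _ = (C₂ / Real.log 2) ^ 4 * Λ ^ 20 := by rw [hT_def]; ring
    _ ≤ (C₂ / Real.log 2) ^ 4 * (D * R ^ ε) := mul_le_mul_of_nonneg_left (hD R hR1) h40
    _ = (C₂ / Real.log 2) ^ 4 * D * R ^ ε := by ring

end Summit.ABC.ABC.Theorems.FewPrimeValuationProduct

end
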